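import Summits.BirchSwinnertonDyer.BirchSwinnertonDyer.Theorems.GenusKolyvaginAtTwoGenusPrimitiveSupplyAtTwoOfRestrictedHabitat
import Literature.NumberTheory.EllipticCurves.MazurRubin2010.TwistSelmerRankControl
import Literature.NumberTheory.EllipticCurves.NoConductorOne
import Literature.NumberTheory.EllipticCurves.HeegnerHypothesisKroneckerProofs
import Literature.NumberTheory.EllipticCurves.HeegnerPointsImaginaryQuadraticProofs
import Literature.NumberTheory.QuadraticFields.FundamentalDiscriminant
import Literature.NumberTheory.QuadraticFields.HeegnerCondition
import HarnessLib

/-!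
# Route `GenusKolyvaginAtTwo`, crux `GenusPrimitiveSupplyAtTwo` (stmt-BirchSwinnertonDyer-22136):
# THE TWIN'S 2-SELMER RANK vs THE CURVE'S — the print half of CONSISTENCY FINDING #2, kernel-checked modulo Mazur–Rubin Prop. 3.3

Width seat bsd-line-gk2-p4 (g6), cell `bsd-f1-sign2`. CONDITIONAL on ONE named print fact
(`MazurRubin2010.prop33_rat`, Mazur–Rubin 2010 Prop. 3.3 over `ℚ`, typed by the `bsd-uniform` cell); nothing is closed; BSD is not
proved by any of this.

WHAT. The crux's ∃K clause asks ONE Kolyvagin-admissible Heegner field `K = ℚ(√d_K)` to carry both a certificate (BSD-side this forces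
`DEF(E,K) = 1`: exactly one prime `q ∣ d_K` with `E(ℚ_q)[2] ≅ ℤ/2` and every other `p ∣ d_K` with `E(ℚ_p)[2] = 0`, on `Δ_E < 0`; the cell's
U-LEDGER (♣) + the lead's (R1) chain) and a `2`-Selmer-minimal twin `Wd ≅ E^{(d_K)}`. This file proves the PRINT half of the seat's finding
(crux workfile `Lines/genus-supply-twin-selmer-rank.md`): for such a `K` — Heegner hypothesis for `N_E` (every `p ∣ N` splits), `2` split
in `K` (automatic when `2 ∣ N`), `Δ_E < 0`, one «transposition» prime `q ∣ d_K` and all other primes of `d_K` «silent», in the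
local-`2`-torsion currency of the fact — Mazur–Rubin's Prop. 3.3 with `T = {q}` gives
`#Sel₂(Wd) ∣ 2·#Sel₂(E)` and `#Sel₂(E) ∣ 2·#Sel₂(Wd)` (`mutual_dvd_two_mul_selmer_twin_of_prop33`), hence
**`#Sel₂(Wd) = 2 ⟹ #Sel₂(E) ∣ 4`** (`natCard_selmerGroup_two_dvd_four_of_minimalTwin_of_prop33`), i.e. `dim_𝔽₂ Sel₂(E) ≤ 2`: the
habitat clause «`Nat.card (W.selmerGroup 2) ≤ 4`» of repair row V14a is NECESSARY for the crux's ∃K clause at every `DEF = 1` field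
(`…le_four…`, and the `2 ∣ N` reading `…_of_two_dvd_conductor…`). The hypotheses of Prop. 3.3 are discharged from the Heegner frame:
additive and multiplicative primes divide `N` (tree: `hasGoodReductionAtPrime_of_not_dvd_conductorNorm'`, Mathlib's
good/multiplicative exclusivity) hence split; split primes do not divide `d_K` (`SatisfiesHeegnerHypothesis.not_dvd_discr`); `d_K` is odd,
square-free, `≠ 1`, and `√d_K ∈ K` (`isFundamentalDiscriminant_discr`, `discr_neg`, `exists_sq_eq_discr`); the real-place clause of
Prop. 3.3 is vacuous on `Δ_E < 0`. The transposition/silent dictionary with the `2`-division cubic (root counts mod `p`) is gk2-p5's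
(`…HeegnerTwinTransposition`, and the Hensel bridge of its g6) and is not redone here. Helper (`--supports stmt-BirchSwinnertonDyer-22136`).
-/

set_option linter.dupNamespace false -- tree convention: `Summit.BirchSwinnertonDyer.BirchSwinnertonDyer.Theorems` (summit = sub-problem)

noncomputable section

open scoped Classical

namespace Summit.BirchSwinnertonDyer.BirchSwinnertonDyer.Theorems.GenusKoly

open NumberField WeierstrassCurve Literature.NumberTheory.EllipticCurves
open Literature.NumberTheory.EllipticCurves.MazurRubin2010

/-- **Mazur–Rubin Prop. 3.3 at a `DEF = 1` Heegner field, `Δ_E < 0`: the twin's and the curve's `2`-Selmer orders differ by exactly one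
factor `2`.** For `E = W/ℚ` elliptic with `Δ_E < 0`, `K` imaginary quadratic with odd `d_K` satisfying the Heegner hypothesis for `N_E`,
`2` split in `K`, a prime `q ∣ d_K` with `#E(ℚ_q)[2] = 2` and `E(ℚ_p)[2] = 0` at every other prime `p ∣ d_K`, and any model `Wd` of the
twist `E^{(d_K)}`: `#Sel₂(Wd) ∣ 2·#Sel₂(E)` and `#Sel₂(E) ∣ 2·#Sel₂(Wd)` — the named fact `prop33_rat` with `F := K`, `d := d_K`,
`T := {q}`; its splitting list is discharged from the Heegner frame (bad primes divide `N_E`, hence split; split primes are prime to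
`d_K`; the real place clause is vacuous for `Δ_E < 0`). CONDITIONAL on `prop33_rat` (PUBLISHED, not proved in the tree).
[cite: MazurRubin2010, Prop. 3.3 with Def. 3.1 and Lemma 2.2 (i)] -/
theorem mutual_dvd_two_mul_selmer_twin_of_prop33 (h33 : prop33_rat)
    (W : WeierstrassCurve ℚ) [W.IsElliptic] (hΔ : W.Δ < 0)
    {K : Type} [Field K] [NumberField K] (hK : IsImaginaryQuadratic K) (hodd : Odd (NumberField.discr K))
    (hH : SatisfiesHeegnerHypothesis (W.conductorNorm ℤ) K)
    (h2 : ((Ideal.span {(2 : ℤ)}).primesOver (𝓞 K)).ncard = 2)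
    (q : ℕ) [Fact q.Prime] (hq : (q : ℤ) ∣ NumberField.discr K)
    (hq2 : Nat.card {Q : (W.baseChange ℚ_[q]).toAffine.Point // 2 • Q = 0} = 2)
    (hT : ∀ (p : ℕ) [Fact p.Prime], (p : ℤ) ∣ NumberField.discr K → p ≠ q →
      ∀ Q : (W.baseChange ℚ_[p]).toAffine.Point, 2 • Q = 0 → Q = 0)
    (Wd : WeierstrassCurve ℚ) [Wd.IsElliptic]
    (hWd : ∃ C : VariableChange ℚ, C • W.quadraticTwist (NumberField.discr K : ℚ) = Wd) :
    Nat.card (Wd.selmerGroup 2) ∣ 2 * Nat.card (W.selmerGroup 2) ∧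
      Nat.card (W.selmerGroup 2) ∣ 2 * Nat.card (Wd.selmerGroup 2) := by
  have hfr : Module.finrank ℚ K = 2 := hK.1
  -- `d_K` is odd, hence square-free, and negative, hence `≠ 1`
  have hsqf : Squarefree (NumberField.discr K) := by
    rcases Literature.NumberTheory.QuadraticFields.Quadratic.isFundamentalDiscriminant_discr (K := K) hfr with h | h
    · exact h.2.1
    · exfalso
      obtain ⟨e, he⟩ := h.1
      exact (Int.not_even_iff_odd.mpr hodd) ⟨2 * e, by rw [he]; ring⟩
  have hne1 : NumberField.discr K ≠ 1 := by
    have := hK.discr_neg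
    omega
  -- `√d_K ∈ K`
  have hx : ∃ x : K, x ^ 2 = ((NumberField.discr K : ℤ) : K) := by
    obtain ⟨-, -, δ, -, hδ⟩ := Literature.NumberTheory.QuadraticFields.Quadratic.exists_sq_eq_discr (K := K) hfr
    refine ⟨(δ : K), ?_⟩
    have := congrArg (algebraMap (𝓞 K) K) hδ
    simpa using this
  -- bad primes divide the conductor, hence split in `K` (Heegner hypothesis)
  have hbad : ∀ (p : ℕ) [Fact p.Prime], ¬ W.HasGoodReductionAtPrime p →
      ((Ideal.span {(p : ℤ)}).primesOver (𝓞 K)).ncard = 2 := by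
    intro p _ hng
    by_contra hns
    exact hng (W.hasGoodReductionAtPrime_of_not_dvd_conductorNorm' fun hpN ↦ hns (hH p Fact.out hpN))
  have hmult_not_good : ∀ (p : ℕ) [Fact p.Prime], W.HasMultiplicativeReductionAtPrime p →
      ¬ W.HasGoodReductionAtPrime p := by
    intro p _ hm hg
    have hm' : ((W.baseChange ℚ_[p]).minimal ℤ_[p]).HasMultiplicativeReduction ℤ_[p] := hm
    have hg' : ((W.baseChange ℚ_[p]).minimal ℤ_[p]).HasGoodReduction ℤ_[p] := hg
    exact hm'.not_hasGoodReduction _ hg'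
  have hmult_dvd : ∀ (p : ℕ) [Fact p.Prime], W.HasMultiplicativeReductionAtPrime p → p ∣ W.conductorNorm ℤ := by
    intro p _ hm
    by_contra hpN
    exact hmult_not_good p hm (W.hasGoodReductionAtPrime_of_not_dvd_conductorNorm' hpN)
  -- the splitting list of Prop. 3.3
  have h1 : ∀ (p : ℕ) [Fact p.Prime], ¬ W.HasGoodReductionAtPrime p → ¬ W.HasMultiplicativeReductionAtPrime p →
      ((Ideal.span {(p : ℤ)}).primesOver (𝓞 K)).ncard = 2 := fun p _ hng _ ↦ hbad p hng
  have h2' : ∀ (p : ℕ) [Fact p.Prime], W.HasMultiplicativeReductionAtPrime p → Even (padicValRat p W.Δ) →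
      ((Ideal.span {(p : ℤ)}).primesOver (𝓞 K)).ncard = 2 := fun p _ hm _ ↦ hbad p (hmult_not_good p hm)
  have h4 : 0 < W.Δ → NumberField.IsTotallyReal K := fun h ↦ absurd h (not_lt.mpr hΔ.le)
  have h5 : ∀ (p : ℕ) [Fact p.Prime], W.HasMultiplicativeReductionAtPrime p → Odd (padicValRat p W.Δ) →
      ¬ (p : ℤ) ∣ NumberField.discr K :=
    fun p _ hm _ ↦ Literature.SatisfiesHeegnerHypothesis.not_dvd_discr hfr hH Fact.out (hmult_dvd p hm)
  -- `T = {q}`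
  have hTin : ∀ p ∈ ({q} : Finset ℕ), p.Prime ∧ (p : ℤ) ∣ NumberField.discr K ∧
      ∀ [Fact p.Prime], Nat.card {Q : (W.baseChange ℚ_[p]).toAffine.Point // 2 • Q = 0} = 2 := by
    intro p hp
    rw [Finset.mem_singleton] at hp
    subst hp
    exact ⟨Fact.out, hq, hq2⟩
  have hTout : ∀ (p : ℕ) [Fact p.Prime], (p : ℤ) ∣ NumberField.discr K → p ∉ ({q} : Finset ℕ) →
      ∀ Q : (W.baseChange ℚ_[p]).toAffine.Point, 2 • Q = 0 → Q = 0 :=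
    fun p _ hp hpq ↦ hT p hp (fun h ↦ hpq (Finset.mem_singleton.mpr h))
  -- the twin, in the fact's orientation
  have hWd' : ∃ C : VariableChange ℚ, C • Wd = W.quadraticTwist ((NumberField.discr K : ℤ) : ℚ) := by
    obtain ⟨C, hC⟩ := hWd
    exact ⟨C⁻¹, by rw [← hC, inv_smul_smul]⟩
  obtain ⟨hA, hB, -⟩ := h33 W (NumberField.discr K) hsqf hne1 K hfr hx h1 h2' h2 h4 h5 {q} hTin hTout Wd hWd'
  rw [Finset.card_singleton, pow_one] at hA hB
  exact ⟨hA, hB⟩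

/-- **`#Sel₂(Wd) = 2 ⟹ #Sel₂(E) ∣ 4` at a `DEF = 1` Heegner field (`Δ_E < 0`).** If the twin at such a field is `2`-Selmer-minimal, the
curve's own `2`-Selmer group has order dividing `4` (`dim_𝔽₂ Sel₂(E) ≤ 2`). So a habitat curve with `#Sel₂(E) > 4` (on the habitat:
`dim Ш(E)[2] ≥ 4`) has NO `2`-Selmer-minimal twin at any such field — the print half of the seat's consistency finding #2; the other half
(`DEF ≠ 1` fields carry no certificate) is BSD-side. CONDITIONAL on `prop33_rat`. [cite: MazurRubin2010, Prop. 3.3] -/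
theorem natCard_selmerGroup_two_dvd_four_of_minimalTwin_of_prop33 (h33 : prop33_rat)
    (W : WeierstrassCurve ℚ) [W.IsElliptic] (hΔ : W.Δ < 0)
    {K : Type} [Field K] [NumberField K] (hK : IsImaginaryQuadratic K) (hodd : Odd (NumberField.discr K))
    (hH : SatisfiesHeegnerHypothesis (W.conductorNorm ℤ) K)
    (h2 : ((Ideal.span {(2 : ℤ)}).primesOver (𝓞 K)).ncard = 2)
    (q : ℕ) [Fact q.Prime] (hq : (q : ℤ) ∣ NumberField.discr K)
    (hq2 : Nat.card {Q : (W.baseChange ℚ_[q]).toAffine.Point // 2 • Q = 0} = 2)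
    (hT : ∀ (p : ℕ) [Fact p.Prime], (p : ℤ) ∣ NumberField.discr K → p ≠ q →
      ∀ Q : (W.baseChange ℚ_[p]).toAffine.Point, 2 • Q = 0 → Q = 0)
    (Wd : WeierstrassCurve ℚ) [Wd.IsElliptic]
    (hWd : ∃ C : VariableChange ℚ, C • W.quadraticTwist (NumberField.discr K : ℚ) = Wd)
    (hSel : Nat.card (Wd.selmerGroup 2) = 2) :
    Nat.card (W.selmerGroup 2) ∣ 4 := by
  have h := (mutual_dvd_two_mul_selmer_twin_of_prop33 h33 W hΔ hK hodd hH h2 q hq hq2 hT Wd hWd).2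
  rwa [hSel] at h

/-- **The V14a habitat clause is necessary at `DEF = 1` fields**: under the hypotheses of
`natCard_selmerGroup_two_dvd_four_of_minimalTwin_of_prop33`, `Nat.card (W.selmerGroup 2) ≤ 4` — literally the clause the seat proposes to
add to the habitat of crux 22136 (repair row V14a). CONDITIONAL on `prop33_rat`. [cite: MazurRubin2010, Prop. 3.3] -/
theorem natCard_selmerGroup_two_le_four_of_minimalTwin_of_prop33 (h33 : prop33_rat)
    (W : WeierstrassCurve ℚ) [W.IsElliptic] (hΔ : W.Δ < 0)
    {K : Type} [Field K] [NumberField K] (hK : IsImaginaryQuadratic K) (hodd : Odd (NumberField.discr K))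
    (hH : SatisfiesHeegnerHypothesis (W.conductorNorm ℤ) K)
    (h2 : ((Ideal.span {(2 : ℤ)}).primesOver (𝓞 K)).ncard = 2)
    (q : ℕ) [Fact q.Prime] (hq : (q : ℤ) ∣ NumberField.discr K)
    (hq2 : Nat.card {Q : (W.baseChange ℚ_[q]).toAffine.Point // 2 • Q = 0} = 2)
    (hT : ∀ (p : ℕ) [Fact p.Prime], (p : ℤ) ∣ NumberField.discr K → p ≠ q →
      ∀ Q : (W.baseChange ℚ_[p]).toAffine.Point, 2 • Q = 0 → Q = 0)
    (Wd : WeierstrassCurve ℚ) [Wd.IsElliptic]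
    (hWd : ∃ C : VariableChange ℚ, C • W.quadraticTwist (NumberField.discr K : ℚ) = Wd)
    (hSel : Nat.card (Wd.selmerGroup 2) = 2) :
    Nat.card (W.selmerGroup 2) ≤ 4 :=
  Nat.le_of_dvd (by norm_num)
    (natCard_selmerGroup_two_dvd_four_of_minimalTwin_of_prop33 h33 W hΔ hK hodd hH h2 q hq hq2 hT Wd hWd hSel)

/-- **The `2 ∣ N` reading** (where `2` splits in every Heegner field automatically, so no `2`-adic escape exists): for `E` with `Δ_E < 0`
and `2 ∣ N_E`, EVERY Heegner field with odd `d_K`, one transposition prime and otherwise silent primes whose twin is `2`-Selmer-minimal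
forces `#Sel₂(E) ≤ 4`. On the crux's habitat (`r_an = 0`, `ρ_{E,2^∞}` onto, so `Sel₂(E) ≅ Ш(E)[2]` BSD-side) this excludes every curve with
`dim Ш(E)[2] ≥ 4` from ever meeting the ∃K clause at a `DEF = 1` field. CONDITIONAL on `prop33_rat`. [cite: MazurRubin2010, Prop. 3.3] -/
theorem natCard_selmerGroup_two_le_four_of_two_dvd_conductor_of_minimalTwin_of_prop33 (h33 : prop33_rat)
    (W : WeierstrassCurve ℚ) [W.IsElliptic] (hΔ : W.Δ < 0) (hN2 : 2 ∣ W.conductorNorm ℤ)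
    {K : Type} [Field K] [NumberField K] (hK : IsImaginaryQuadratic K) (hodd : Odd (NumberField.discr K))
    (hH : SatisfiesHeegnerHypothesis (W.conductorNorm ℤ) K)
    (q : ℕ) [Fact q.Prime] (hq : (q : ℤ) ∣ NumberField.discr K)
    (hq2 : Nat.card {Q : (W.baseChange ℚ_[q]).toAffine.Point // 2 • Q = 0} = 2)
    (hT : ∀ (p : ℕ) [Fact p.Prime], (p : ℤ) ∣ NumberField.discr K → p ≠ q →
      ∀ Q : (W.baseChange ℚ_[p]).toAffine.Point, 2 • Q = 0 → Q = 0)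
    (Wd : WeierstrassCurve ℚ) [Wd.IsElliptic]
    (hWd : ∃ C : VariableChange ℚ, C • W.quadraticTwist (NumberField.discr K : ℚ) = Wd)
    (hSel : Nat.card (Wd.selmerGroup 2) = 2) :
    Nat.card (W.selmerGroup 2) ≤ 4 :=
  natCard_selmerGroup_two_le_four_of_minimalTwin_of_prop33 h33 W hΔ hK hodd hH (hH 2 Nat.prime_two hN2) q hq hq2 hT Wd hWd hSel

/-! ### §2 Read against the crux: at a big-Selmer habitat curve the crux's witness field is not of `DEF = 1` shape -/

open Summit.BirchSwinnertonDyer.BirchSwinnertonDyer.Theses.GenusKolyvaginAtTwo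
  Literature.NumberTheory.EllipticCurves.ModularForms in
/-- **`prop33_rat` ⟹ (crux 22136 ⟹ at every habitat curve with `Δ_E < 0`, `2 ∣ N_E` and `#Sel₂(E) > 4` the witnessing Heegner field is
NOT of `DEF = 1` shape).** Granted Mazur–Rubin Prop. 3.3 (`prop33_rat`) and the crux `GenusPrimitiveSupplyAtTwo` AS TYPED, for `W` on the
habitat with `W.Δ < 0`, `2 ∣ N` and `4 < #Sel₂(W)`, the field `K` the crux supplies (odd `d_K`, Heegner, with a `2`-Selmer-minimal twin)
admits NO prime `q ∣ d_K` with `#E(ℚ_q)[2] = 2` such that all other primes of `d_K` have `E(ℚ_p)[2] = 0` — i.e. `DEF(E,K) ≠ 1` in the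
local-`2`-torsion currency. Since BSD-side a `DEF ≠ 1` field carries no certificate (U-LEDGER (♣), lead's (R1) chain), this is the
kernel form of the seat's finding #2: the crux as typed is BSD+MR-inconsistent at such curves, and the habitat clause
`Nat.card (W.selmerGroup 2) ≤ 4` (V14a) removes them. CONDITIONAL on `prop33_rat` and on the crux (both hypotheses displayed).
[cite: MazurRubin2010, Prop. 3.3] -/
theorem witnessField_not_defOneShape_of_prop33_of_genusPrimitiveSupplyAtTwo (h33 : prop33_rat)
    (hP : GenusPrimitiveSupplyAtTwo)
    (W : WeierstrassCurve ℚ) [W.IsElliptic] [W.IsGloballyMinimal] [NeZero (W.conductorNorm ℤ)]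
    (hcm : ¬ W.HasCM) (hr0 : W.analyticRank = 0) (hρ : ∀ n : ℕ, 0 < n → W.HasSurjectiveModNGaloisRep ((2 : ℤ) ^ n))
    (hTam : Odd W.tamagawaProduct)
    (hopt : ∃ Dt : ModularParametrizationData W (W.conductorNorm ℤ),
      (∀ z ∈ Dt.L.lattice, ∃ w ∈ periodLattice Dt.f, z = (Dt.c : ℂ) * w) ∧ Odd Dt.c)
    (hΔ : W.Δ < 0) (hN2 : 2 ∣ W.conductorNorm ℤ) (hbig : 4 < Nat.card (W.selmerGroup 2)) :
    ∃ (K : Type) (_ : Field K) (_ : NumberField K),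
      IsImaginaryQuadratic K ∧ Odd (NumberField.discr K) ∧ SatisfiesHeegnerHypothesis (W.conductorNorm ℤ) K ∧
      (∃ (Wd : WeierstrassCurve ℚ) (_ : Wd.IsElliptic),
        (∃ C : VariableChange ℚ, C • W.quadraticTwist (NumberField.discr K : ℚ) = Wd) ∧ Nat.card (Wd.selmerGroup 2) = 2) ∧
      ∀ (q : ℕ) [Fact q.Prime], (q : ℤ) ∣ NumberField.discr K →
        Nat.card {Q : (W.baseChange ℚ_[q]).toAffine.Point // 2 • Q = 0} = 2 →
        ¬ ∀ (p : ℕ) [Fact p.Prime], (p : ℤ) ∣ NumberField.discr K → p ≠ q →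
            ∀ Q : (W.baseChange ℚ_[p]).toAffine.Point, 2 • Q = 0 → Q = 0 := by
  obtain ⟨K, iF, iN, hIQ, hodd, -, hHe, -, -, -, -, -, -, -, -, -, -, -, -, -, -, -, -, -, Wd, iE, -, hWd, -, -, hSel⟩ :=
    hP W hcm hr0 hρ hTam hopt
  refine ⟨K, iF, iN, hIQ, hodd, hHe, ⟨Wd, iE, hWd, hSel⟩, fun q _ hq hq2 hT ↦ ?_⟩
  have hle := natCard_selmerGroup_two_le_four_of_two_dvd_conductor_of_minimalTwin_of_prop33 h33 W hΔ hN2 hIQ hodd hHe q hq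
    hq2 hT Wd hWd hSel
  omega

end Summit.BirchSwinnertonDyer.BirchSwinnertonDyer.Theorems.GenusKoly

end
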